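import Summits.SmoothPoincare4.SmoothPoincare4.Theses.HyperbolicTorusFillings
import Literature.Topology.FourManifolds.TorusSurgery
import Literature.Topology.FourManifolds.GluckTwist
import Literature.Topology.FourManifolds.SurgeryGluck
import HarnessLib
import HarnessLib.Audit

/-!
# Birth skeleton (BC3) — crux `HyperbolicTorusFillings.LinkSurgeryPropertyP` (item stmt-SmoothPoincare4-3359)

Route `route-SmoothPoincare4-HyperbolicTorusFillings`, crux #4 `LinkSurgeryPropertyP` (P = "four-dimensional
Property P, link form"): for every Hausdorff second-countable smooth 4-manifold `M` (atlas on `ℝ⁴`, `C^∞`) that IS a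
simultaneous torus surgery on `S⁴` along a framed link of tori `T₁,…,Tₙ` with regluing matrices `Aᵢ ∈ GL(3,ℤ)` —
the predicate inlined in the route decl is, by `Iff.rfl`, the landed definition
`Literature.Topology.FourManifolds.IsTorusLinkSurgery (𝓡 4) M n T A` (`TorusSurgery.lean`,
`isTorusLinkSurgery_iff`) — a homotopy equivalence `M ≃ₕ S⁴` forces `M ≅ S⁴` (`C^∞` diffeomorphic).

## The line `birth` — GLUCK NORMAL FORM + GLUCK RECOGNITION (the converse of Iwase's theorem)

Vocabulary (tree only, no new definitions): `IsTorusLinkSurgery` (torus-link surgery, relational open-gluing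
form), `TwoKnot` (smooth 2-knots `S² ↪ S⁴`, `Knots.lean`), `IsGluckTwist (𝓡 4) X K` (`X` is the Gluck twist of `S⁴`
along `K`, relational form, `GluckTwist.lean`), `GluckTwistConjecture` (registered OPEN conjecture, Kirby 4.24,
`SurgeryGluck.lean`).

WHY GLUCK TWISTS (Iwase1988 §1 and Prop. 3.5; Larson2018 §1). There are two four-dimensional Dehn surgeries on
`S⁴`: the Gluck twist along a 2-knot (`N = S² × D²`, `π₀ Diff ∂N ⊇ ℤ/2`, ONE new manifold per 2-knot, always a
homotopy 4-sphere — Gluck 1962 §17, tree theorem `IsGluckTwist.nonempty_homotopyEquiv_sphere`) and torus surgery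
along a `T²`-knot / link (`N = T² × D²`, `π₀ Diff ∂N = GL₃ℤ`, countably many manifolds per torus, most of them not
simply connected). Iwase's Proposition 3.5 (tree NAMED FACT `Iwase1988_gluckTwist_isTorusLinkSurgery`) embeds the
first in the second: a Gluck twist along `K` is the torus surgery of type `(1,0,±1)` along the torus `K'` = `K`
with a trivial tube; with it the tree PROVES `P → GluckTwistConjecture`
(`GluckTwistConjecture.of_iwase_of_torusSurgeryPropertyP`). THIS LINE IS THE CONVERSE INCLUSION ON HOMOTOPY
SPHERES: the homotopy 4-spheres produced by torus-link surgery on `S⁴` are exactly the Gluck twists of `S⁴`, so that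
P factors as

  P ⟸ (STUB 1: Gluck normal form of torus-surgery homotopy spheres) ∧ (STUB 2: Gluck twists are standard),

and conversely P ⟹ STUB 1 (trivially: `M ≅ S⁴` is the Gluck twist along the unknot, tree fact
`isGluckTwist_sphere_unknotTwo`, transported along the diffeomorphism) and P ⟹ STUB 2 modulo Iwase's published
Prop. 3.5 (the tree bridge just quoted). So the split is an honest FACTORISATION `P ⟺ STUB 1 ∧ STUB 2` (in
substance, modulo Iwase 1988), adding no falsity risk beyond P itself, and it separates a NORMAL-FORM half
(4-dimensional handle/torus calculus: turn a log-transform presentation of a homotopy sphere into a Gluck-twist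
presentation) from a RECOGNITION half (the Gluck twist conjecture, with its own fifty-year toolbox), with disjoint
techniques:

* STUB 1 `stub_gluckNormalForm` — GLUCK NORMAL FORM (open; the torus-calculus half): every homotopy 4-sphere `M`
  that is a torus-link surgery on `S⁴` (`IsTorusLinkSurgery (𝓡 4) M n T A`, `M ≃ₕ S⁴`) is a Gluck twist of `S⁴` along
  SOME 2-knot `K` (`IsGluckTwist (𝓡 4) M K`). Engine and known strata: (i) `n = 0` and the UNKNOTTED torus —
  Montesinos 1983 (quoted in Iwase1988 §3, p. 294: "any homotopy 4-sphere obtained by Dehn-surgery along an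
  unknotted T²-knot in S⁴ is diffeomorphic to S⁴"), Larson2018 §5 (surgeries on the unknotted torus give `S⁴`,
  `S¹×S³ # S²×S²`, `S¹×S³ # S²×~S²`) — here `K` = unknot; (ii) TORUS `T²`-KNOTS `S(k(p,q))`, `S̃(k(p,q))` — Iwase1988
  Thm 1.3 classifies all their Dehn surgeries (good torus fibrations, Pao's `L_m`, `L'_m`); (iii) SPUN and TWISTED-SPUN
  tori `T_K`, `T'_K` — Larson2018 §3 (Prop. 6: `T'_K` lies in a fishtail neighbourhood, Gompf's vanishing-cycle
  calculus; the route's support item `SpunTorusSurgeries`); (iv) the general mechanism: a multiplicity-one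
  logarithmic transformation along a curve `γ ⊂ T` that bounds a framed disc in the exterior is a Gluck twist on the
  2-sphere obtained by surgering `T` along that disc (Gompf–Stipsicz 1999 §6.2/§8.3 calculus; Iwase's Prop. 3.5 read
  backwards), and for a homotopy-sphere result the multiplicity is forced to be `±1` in the canonical framing
  (`H₁ = ℤ/p`, Iwase1988 Prop. 3.3 (ii), Larson2018 §2). It is NOT the crux: `M` is allowed to be a (potentially
  exotic) Gluck twist, and no cheap tactic closes `STUB 1 → P` or `STUB 1 → SmoothPoincare4` (BC3 probes below).
  Why it might fail: a homotopy sphere of torus-surgery origin on the MOSTOW-RIGID stratum (hyperbolic core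
  complement, the route's rank-2 item `HyperbolicFillingsStandard`: `π₁`-injective peripheral `T³`, NO compressing
  discs) that is not a Gluck twist of `S⁴` along any 2-knot — the disc mechanism (iv) is void there, so on that
  stratum STUB 1 is as open as P. Size: open problem (L on strata (i)–(iii)).
* STUB 2 `stub_gluckTwistsStandard` — GLUCK RECOGNITION (open): every Gluck twist of `S⁴` along every 2-knot is
  diffeomorphic to `S⁴`. VERBATIM the body of the tree's registered open conjecture
  `Literature.Topology.FourManifolds.GluckTwistConjecture.{0}` (`Iff.rfl` below) — Kirby1997 Problem 4.24, Gluck 1962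
  §17; status open (Gabai–Naylor–Schwartz 2025 §2.1). Known cases (SurgeryGluck.lean docstring): ribbon and
  twist-spun 2-knots (Gluck 1962; Gordon 1976; Pao 1978), 2-knots 0-concordant to those (Melvin 1977), unknot (tree:
  `nonempty_diffeomorph_sphere_four_of_isGluckTwist_of_isUnknot_of`), GNS 2025 doubles. It is NOT the crux and not
  the summit: `GluckTwistConjecture → P` needs STUB 1 and `GluckTwistConjecture → SmoothPoincare4` is not known (BC3
  probes below); conversely `P → STUB 2` is the tree bridge modulo Iwase. Why it might fail: an exotic Gluck twist
  (= ¬SPC4; the live thesis `GlasThesis` of the CLOSED route GluckLasagna), invisible to every `ℂP²`-stable invariant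
  (`Literature.Barriers.SmoothPoincare4.GluckTwistCP2Barrier`). Size: open problem.

COMPOSITION (kernel-checked, no `sorry` outside the two stubs): `linkSurgeryPropertyP_of_stubs : ⟨stub₁-sig⟩ →
⟨stub₂-sig⟩ → ⟨the crux statement, verbatim⟩` (three tactic lines: take `(M, n, T, A)`, the surgery witness `h` and
`e : M ≃ₕ S⁴`; STUB 1 gives `K` with `IsGluckTwist (𝓡 4) M K` — the inlined block IS `IsTorusLinkSurgery (𝓡 4) M n T A`
by `isTorusLinkSurgery_iff`; STUB 2 at `(K, M)` is the goal) and THE skeleton theorem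
`LinkSurgeryPropertyP_of : HyperbolicTorusFillings.LinkSurgeryPropertyP := linkSurgeryPropertyP_of_stubs
stub_gluckNormalForm stub_gluckTwistsStandard` — the crux BY NAME, closed modulo the two registered stubs;
deliberately the only theorem of the file whose conclusion is the crux constant (the arrow form with the crux by
name is certified by the closing `example`, as in the registered skeletons of `InvolutionQuotient` /
`PscSpheresStandard`).

HARDEST STUB: `stub_gluckTwistsStandard` on its face (the Gluck twist conjecture); but `stub_gluckNormalForm` is the
one without an engine on the hyperbolic stratum, which is exactly where the route's own rank-2 crux
`HyperbolicFillingsStandard` (2π theorem + short-filling census) is meant to work — the two lines are complementary: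
this skeleton handles the compressible strata by Gluck calculus and hands the recognition to Kirby 4.24.

## Disproof used / negatives

No `Disproof.lean`, no dead line, no landed `Negative/` lemma exists for this crux (`ledger crux ls
stmt-SmoothPoincare4-3359`: "(no workfiles yet)", 2026-08-17) and `ledger negatives --problem SmoothPoincare4` lists
0 refuted statements (2026-08-17). Item evidence inherited: refuter route-review stamp 2026-08-15 (5/5 decls
elaborate; the TLS predicate read symbol-by-symbol is a faithful torus-link surgery: `n = 0 ⇒ M ≅ S⁴` via `jA`;
`n ≥ 1 ⇒` the fibre relation is the graph of `T_i ∘ ψ_(A_i)` on the punctured tube, single-valued because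
`A ∈ GL(3,ℤ)`), grounder g18-7 stamp 2026-08-15 (OPEN / NEW; contains the Gluck twist conjecture via the checked
one-liner over Iwase's fact — the direction `P → STUB 2` used above). STUB 1 keeps the crux hypotheses verbatim
(through `IsTorusLinkSurgery`, definitionally the inlined block), so the same sanity analysis applies and it is not
vacuous (`S⁴` with `n = 0` is an instance; `IsTorusLinkSurgery.nonempty`); STUB 2 quantifies over genuine Gluck
twists, which exist and are nonempty (tree `exists_isGluckTwist`, `IsGluckTwist.nonempty`).

## Barriers (route header, specialised to this line)

`GluckTwistCP2Barrier` (every `ℂP²`-stable invariant dies on Gluck twists; THEOREM in the tree): says STUB 2 cannot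
be REFUTED by stable invariants; it does not obstruct a positive proof, and the positive tools (ribbon/twist-spin
fibrations, circle actions, 0-concordance, GNS's 5-dimensional doubles) are unstable. `CircleActionBarrierFour`:
used positively exactly as in the route header (spun / `S¹`-symmetric strata are standard by Fintushel–Pao; they
feed STUB 1 (iii)). `HCobordismBarrierFour`, `GaugeSumBarrierFour`, `TopologicalBarrierFour`, `StableBarrierFour`:
not engaged (no h-cobordism step; no invariant of a candidate is evaluated; all manifolds here are already
homeomorphic to `S⁴`). `CappellShanesonFamilyBarrier`: not engaged (no CS construction).

## BC3 probes (registrar, 2026-08-17)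

For each stub `X ∈ {stub_gluckNormalForm, stub_gluckTwistsStandard}`: `X-sig → LinkSurgeryPropertyP` and
`X-sig → SmoothPoincare4` by `first | exact? | simpa | aesop` (and the BC2-shaped battery with `simpa [defs]`,
`unfold; simpa`) — all FAIL (files `bc/probe_*.lean` of the registrar folder; rc and residual goals quoted in the
registrar's NOTES.md, in `Lines/birth.md` and in the evidence note on the item).

## References

* Z. Iwase, *Dehn-surgery along a torus T²-knot*, Pacific J. Math. 133 (1988) 289–299, §1, Prop. 3.3, Prop. 3.5,
  Cor. 3.8 (doi:10.2140/pjm.1988.133.289; READ, held `paper:iwase1988-dehn-surgery-along-torus-i-t-i` pp. 2–3, 7–11).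
  [Iwase1988]
* K. Larson, *Surgery on tori in the 4-sphere*, Math. Proc. Cambridge Philos. Soc. (2018), arXiv:1502.06834, §§1–3, 5
  (READ pp. 2, 5–6, 10). [Larson2018]
* J. M. Montesinos, *On twins in the four-sphere I*, Quart. J. Math. Oxford 34 (1983) 171–199, p. 187 (as quoted by
  Iwase1988 §3). [Montesinos1983]
* H. Gluck, *The embedding of two-spheres in the four-sphere*, Trans. AMS 104 (1962), §§8, 17. [Gluck1962]
* R. Gompf, A. Stipsicz, *4-Manifolds and Kirby Calculus*, GSM 20 (1999), §6.2 (Gluck twist), §8.3 (logarithmic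
  transformations). [GompfStipsicz1999]
* D. Gabai, P. Naylor, H. Schwartz, *Doubles of Gluck twists: a five-dimensional approach*, Adv. Math. 480 (2025)
  110455, arXiv:2307.06388, §2.1 (status of Kirby 4.24). [GabaiNaylorSchwartz2025]
* R. Kirby (ed.), *Problems in low-dimensional topology* (1997), Problems 4.24, 4.89. [Kirby1997]
-/

-- `Summit.<Summit>.<Problem>`: single-conjunct summit, the duplicate component is mandated (CONVENTIONS §2).
set_option linter.dupNamespace false
set_option linter.unusedVariables false

noncomputable section

namespace Summit.SmoothPoincare4.SmoothPoincare4.Cruxes.LinkSurgeryPropertyP.Birth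

open scoped Manifold ContDiff Topology

/-! ## The two registered stubs (`sorry` lives ONLY here; signatures spelled out over tree declarations)

Inline vocabulary: `S⁴ := Metric.sphere (0 : EuclideanSpace ℝ (Fin 5)) 1`, `S¹ := Metric.sphere (0 :
EuclideanSpace ℝ (Fin 2)) 1` (Mathlib manifold structures, models `𝓡 4`, `𝓡 1`); the torus-link-surgery datum
`(M, n, T, A)` with `IsTorusLinkSurgery (𝓡 4) M n T A` = the hypotheses of the crux (definitionally,
`Literature.Topology.FourManifolds.isTorusLinkSurgery_iff`). -/

/-- **STUB 1 `stub_gluckNormalForm` — GLUCK NORMAL FORM of torus-surgery homotopy spheres (registered; open).**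
For every Hausdorff second-countable smooth 4-manifold `M` that is a torus surgery on `S⁴` along a framed link of
`n` tori with regluing matrices `A i ∈ GL(3,ℤ)` (`IsTorusLinkSurgery (𝓡 4) M n T A`, the crux hypothesis) and every
homotopy equivalence `M ≃ₕ S⁴`, there is a 2-knot `K : S² ↪ S⁴` such that `M` is a Gluck twist of `S⁴` along `K`
(`IsGluckTwist (𝓡 4) M K`). The converse inclusion to Iwase1988 Prop. 3.5 on homotopy spheres. Implied by the
crux (unknot: `isGluckTwist_sphere_unknotTwo`); known on the unknotted torus (Montesinos 1983 via Iwase1988 §3;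
Larson2018 §5), on torus `T²`-knots (Iwase1988 Thm 1.3) and on spun / twisted-spun tori (Larson2018 §3); general
mechanism: a multiplicity-`±1` log transform along a curve bounding a framed disc in the exterior is a Gluck twist
on the surgered sphere (Gompf–Stipsicz §§6.2, 8.3). Not the crux: `M` may be an exotic Gluck twist. Size: open
problem. [Iwase1988, Prop. 3.5, Thm 1.3] [Larson2018, §§3, 5] [GompfStipsicz1999, §§6.2, 8.3] -/
theorem stub_gluckNormalForm :
    ∀ (M : Type) [TopologicalSpace M] [T2Space M] [SecondCountableTopology M]
      [ChartedSpace (EuclideanSpace ℝ (Fin 4)) M] [IsManifold (𝓡 4) ∞ M] (n : ℕ)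
      (T : Fin n → (↥(Metric.sphere (0 : EuclideanSpace ℝ (Fin 2)) 1) × ↥(Metric.sphere (0 : EuclideanSpace ℝ (Fin 2)) 1)) × EuclideanSpace ℝ (Fin 2) → ↥(Metric.sphere (0 : EuclideanSpace ℝ (Fin 5)) 1))
      (A : Fin n → Matrix (Fin 3) (Fin 3) ℤ),
      Literature.Topology.FourManifolds.IsTorusLinkSurgery (𝓡 4) M n T A →
      ContinuousMap.HomotopyEquiv M ↥(Metric.sphere (0 : EuclideanSpace ℝ (Fin 5)) 1) →
      ∃ K : Literature.Topology.FourManifolds.TwoKnot,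
        Literature.Topology.FourManifolds.IsGluckTwist (𝓡 4) M K := by
  sorry

/-- **STUB 2 `stub_gluckTwistsStandard` — GLUCK RECOGNITION = the Gluck twist conjecture (registered; open).**
For every 2-knot `K : S² ↪ S⁴` and every Hausdorff second-countable smooth 4-manifold `X` that is a Gluck twist of
`S⁴` along `K` (`IsGluckTwist (𝓡 4) X K`), `X` is diffeomorphic to `S⁴`. Verbatim the body of the registered open
conjecture `Literature.Topology.FourManifolds.GluckTwistConjecture` at universe `0` (`Iff.rfl` below): Gluck 1962
§17, Kirby1997 Problem 4.24, open per Gabai–Naylor–Schwartz 2025 §2.1. Implied by the crux modulo Iwase1988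
Prop. 3.5 (tree bridge `GluckTwistConjecture.of_iwase_of_torusSurgeryPropertyP`). Known for ribbon and twist-spun
2-knots, 0-concordant companions, the unknot (`nonempty_diffeomorph_sphere_four_of_isGluckTwist_of_isUnknot_of`).
Not the crux (needs STUB 1) and not the summit. Size: open problem.
[Gluck1962, §17] [Kirby1997, Problem 4.24] [GabaiNaylorSchwartz2025, §2.1] -/
theorem stub_gluckTwistsStandard :
    ∀ (K : Literature.Topology.FourManifolds.TwoKnot) (X : Type) [TopologicalSpace X] [T2Space X]
      [SecondCountableTopology X] [ChartedSpace (EuclideanSpace ℝ (Fin 4)) X] [IsManifold (𝓡 4) ∞ X],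
      Literature.Topology.FourManifolds.IsGluckTwist (𝓡 4) X K →
      Nonempty (X ≃ₘ⟮𝓡 4, 𝓡 4⟯ ↥(Metric.sphere (0 : EuclideanSpace ℝ (Fin 5)) 1)) := by
  sorry

/-! ## Identifications with tree declarations (shared work: one proof closes both spellings) -/

/-- STUB 2 is literally the registered open conjecture `GluckTwistConjecture` at universe `0`. [folklore] -/
example :
    (∀ (K : Literature.Topology.FourManifolds.TwoKnot) (X : Type) [TopologicalSpace X] [T2Space X]
      [SecondCountableTopology X] [ChartedSpace (EuclideanSpace ℝ (Fin 4)) X] [IsManifold (𝓡 4) ∞ X],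
      Literature.Topology.FourManifolds.IsGluckTwist (𝓡 4) X K →
      Nonempty (X ≃ₘ⟮𝓡 4, 𝓡 4⟯ ↥(Metric.sphere (0 : EuclideanSpace ℝ (Fin 5)) 1))) ↔
      Literature.Topology.FourManifolds.GluckTwistConjecture.{0} :=
  Iff.rfl

/-! ## Composition: stubs ⟹ crux (no `sorry` below this line) -/

/-- **The Gluck split of P, arrow form**: if every torus-link-surgery homotopy 4-sphere is a Gluck twist of `S⁴`
(STUB 1) and Gluck twists of `S⁴` are standard (STUB 2), then every torus-link surgery on `S⁴` that is homotopy
equivalent to `S⁴` is diffeomorphic to `S⁴` — the statement of the crux `HyperbolicTorusFillings.LinkSurgeryPropertyP`,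
VERBATIM (so that this arrow theorem is not itself a by-name candidate for the skeleton audit; the by-name theorem
is `LinkSurgeryPropertyP_of` below). Pure logic: the inlined block is `IsTorusLinkSurgery (𝓡 4) M n T A` by
`isTorusLinkSurgery_iff` (`Iff.rfl`). [folklore] -/
theorem linkSurgeryPropertyP_of_stubs
    (h₁ : ∀ (M : Type) [TopologicalSpace M] [T2Space M] [SecondCountableTopology M]
      [ChartedSpace (EuclideanSpace ℝ (Fin 4)) M] [IsManifold (𝓡 4) ∞ M] (n : ℕ)
      (T : Fin n → (↥(Metric.sphere (0 : EuclideanSpace ℝ (Fin 2)) 1) × ↥(Metric.sphere (0 : EuclideanSpace ℝ (Fin 2)) 1)) × EuclideanSpace ℝ (Fin 2) → ↥(Metric.sphere (0 : EuclideanSpace ℝ (Fin 5)) 1))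
      (A : Fin n → Matrix (Fin 3) (Fin 3) ℤ),
      Literature.Topology.FourManifolds.IsTorusLinkSurgery (𝓡 4) M n T A →
      ContinuousMap.HomotopyEquiv M ↥(Metric.sphere (0 : EuclideanSpace ℝ (Fin 5)) 1) →
      ∃ K : Literature.Topology.FourManifolds.TwoKnot,
      Literature.Topology.FourManifolds.IsGluckTwist (𝓡 4) M K)
    (h₂ : ∀ (K : Literature.Topology.FourManifolds.TwoKnot) (X : Type) [TopologicalSpace X] [T2Space X]
      [SecondCountableTopology X] [ChartedSpace (EuclideanSpace ℝ (Fin 4)) X] [IsManifold (𝓡 4) ∞ X],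
      Literature.Topology.FourManifolds.IsGluckTwist (𝓡 4) X K →
      Nonempty (X ≃ₘ⟮𝓡 4, 𝓡 4⟯ ↥(Metric.sphere (0 : EuclideanSpace ℝ (Fin 5)) 1))) :
    ∀ (M : Type) [TopologicalSpace M] [T2Space M] [SecondCountableTopology M] [ChartedSpace (EuclideanSpace ℝ (Fin 4)) M] [IsManifold (𝓡 4) ∞ M] (n : ℕ) (T : Fin n → (↥(Metric.sphere (0 : EuclideanSpace ℝ (Fin 2)) 1) × ↥(Metric.sphere (0 : EuclideanSpace ℝ (Fin 2)) 1)) × EuclideanSpace ℝ (Fin 2) → ↥(Metric.sphere (0 : EuclideanSpace ℝ (Fin 5)) 1)) (A : Fin n → Matrix (Fin 3) (Fin 3) ℤ), ((∀ i, Manifold.IsSmoothEmbedding (((𝓡 1).prod (𝓡 1)).prod 𝓘(ℝ, EuclideanSpace ℝ (Fin 2))) (𝓡 4) ∞ (T i)) ∧ Pairwise (fun i j => Disjoint (Set.range (T i)) (Set.range (T j))) ∧ (∀ i, (A i).det = 1 ∨ (A i).det = -1) ∧ ∃ (U : TopologicalSpace.Opens ↥(Metric.sphere (0 : EuclideanSpace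 ℝ (Fin 5)) 1)) (jA : ↥U → M) (jB : Fin n → (↥(Metric.sphere (0 : EuclideanSpace ℝ (Fin 2)) 1) × ↥(Metric.sphere (0 : EuclideanSpace ℝ (Fin 2)) 1)) × EuclideanSpace ℝ (Fin 2) → M), (U : Set ↥(Metric.sphere (0 : EuclideanSpace ℝ (Fin 5)) 1)) = (⋃ i, Set.range (fun x : (↥(Metric.sphere (0 : EuclideanSpace ℝ (Fin 2)) 1) × ↥(Metric.sphere (0 : EuclideanSpace ℝ (Fin 2)) 1)) => T i (x, 0)))ᶜ ∧ Manifold.IsSmoothEmbedding (𝓡 4) (𝓡 4) ∞ jA ∧ IsOpen (Set.range jA) ∧ (∀ i, Manifold.IsSmoothEmbedding (((𝓡 1).prod (𝓡 1)).prod 𝓘(ℝ, EuclideanSpace ℝ (Fin 2))) (𝓡 4) ∞ (jB i) ∧ IsOpen (Set.range (jB i))) ∧ Set.range jA ∪ (⋃ i, Set.range (jB i)) = Set.univ ∧ Pairwise (fun i j => Disjoint (Set.range (jB i)) (Set.range (jB j))) ∧ ∀ (i : Fin n) (a : ↥U) (b : (↥(Metric.sphere (0 : EuclideanSpace ℝ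 (Fin 2)) 1) × ↥(Metric.sphere (0 : EuclideanSpace ℝ (Fin 2)) 1)) × EuclideanSpace ℝ (Fin 2)), (jA a = jB i b ↔ ∃ θ₁ θ₂ θ₃ t : ℝ, 0 < t ∧ b = ((Literature.Topology.FourManifolds.circlePoint (θ₁), Literature.Topology.FourManifolds.circlePoint (θ₂)), t • ((Literature.Topology.FourManifolds.circlePoint (θ₃) : ↥(Metric.sphere (0 : EuclideanSpace ℝ (Fin 2)) 1)) : EuclideanSpace ℝ (Fin 2))) ∧ (a : ↥(Metric.sphere (0 : EuclideanSpace ℝ (Fin 5)) 1)) = T i ((Literature.Topology.FourManifolds.circlePoint ((A i 0 0 : ℝ) * θ₁ + (A i 0 1 : ℝ) * θ₂ + (A i 0 2 : ℝ) * θ₃), Literature.Topology.FourManifolds.circlePoint ((A i 1 0 : ℝ) * θ₁ + (A i 1 1 : ℝ) * θ₂ + (A i 1 2 : ℝ) * θ₃)), t • ((Literature.Topology.FourManifolds.circlePoint ((A i 2 0 : ℝ) * θ₁ + (A i 2 1 : ℝ) * θ₂ + (A i 2 2 : ℝ) * θ₃) : ↥(Metric.sphere (0 : EuclideanSpace ℝ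 (Fin 2)) 1)) : EuclideanSpace ℝ (Fin 2))))) → ContinuousMap.HomotopyEquiv M ↥(Metric.sphere (0 : EuclideanSpace ℝ (Fin 5)) 1) → Nonempty (M ≃ₘ⟮𝓡 4, 𝓡 4⟯ ↥(Metric.sphere (0 : EuclideanSpace ℝ (Fin 5)) 1)) := by
  intro M _ _ _ _ _ n T A h e
  obtain ⟨K, hK⟩ :=
    h₁ M n T A ((Literature.Topology.FourManifolds.isTorusLinkSurgery_iff M n T A).mpr h) e
  exact h₂ K M hK

/-- **`LinkSurgeryPropertyP_of` — THE SKELETON**: the crux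
`Summit.SmoothPoincare4.SmoothPoincare4.Theses.HyperbolicTorusFillings.LinkSurgeryPropertyP` BY NAME, closed
modulo the two registered stubs (D-0027 §3.3 shape `<Crux>_proof := crux_of stub₁_holds stub₂_holds`). Becomes
the crux proof when both stubs are discharged. [folklore] -/
theorem LinkSurgeryPropertyP_of :
    Summit.SmoothPoincare4.SmoothPoincare4.Theses.HyperbolicTorusFillings.LinkSurgeryPropertyP :=
  linkSurgeryPropertyP_of_stubs stub_gluckNormalForm stub_gluckTwistsStandard

/-- BC3 letter: `⟨stub₁-sig⟩ → ⟨stub₂-sig⟩ → LinkSurgeryPropertyP` with the crux BY NAME (an `example`, so that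
`LinkSurgeryPropertyP_of` stays the only by-name candidate the skeleton audit sees). -/
example :
    (∀ (M : Type) [TopologicalSpace M] [T2Space M] [SecondCountableTopology M]
      [ChartedSpace (EuclideanSpace ℝ (Fin 4)) M] [IsManifold (𝓡 4) ∞ M] (n : ℕ)
      (T : Fin n → (↥(Metric.sphere (0 : EuclideanSpace ℝ (Fin 2)) 1) × ↥(Metric.sphere (0 : EuclideanSpace ℝ (Fin 2)) 1)) × EuclideanSpace ℝ (Fin 2) → ↥(Metric.sphere (0 : EuclideanSpace ℝ (Fin 5)) 1))
      (A : Fin n → Matrix (Fin 3) (Fin 3) ℤ),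
      Literature.Topology.FourManifolds.IsTorusLinkSurgery (𝓡 4) M n T A →
      ContinuousMap.HomotopyEquiv M ↥(Metric.sphere (0 : EuclideanSpace ℝ (Fin 5)) 1) →
      ∃ K : Literature.Topology.FourManifolds.TwoKnot,
      Literature.Topology.FourManifolds.IsGluckTwist (𝓡 4) M K) →
    (∀ (K : Literature.Topology.FourManifolds.TwoKnot) (X : Type) [TopologicalSpace X] [T2Space X]
      [SecondCountableTopology X] [ChartedSpace (EuclideanSpace ℝ (Fin 4)) X] [IsManifold (𝓡 4) ∞ X],
      Literature.Topology.FourManifolds.IsGluckTwist (𝓡 4) X K →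
      Nonempty (X ≃ₘ⟮𝓡 4, 𝓡 4⟯ ↥(Metric.sphere (0 : EuclideanSpace ℝ (Fin 5)) 1))) →
    Summit.SmoothPoincare4.SmoothPoincare4.Theses.HyperbolicTorusFillings.LinkSurgeryPropertyP :=
  linkSurgeryPropertyP_of_stubs

/-- Sanity (direction already in the tree): the crux implies STUB 2 modulo Iwase's Prop. 3.5 — the proved bridge
`GluckTwistConjecture.of_iwase_of_torusSurgeryPropertyP`, whose second hypothesis is the crux written over
`IsTorusLinkSurgery` (definitionally the crux). [Iwase1988, Prop. 3.5] -/
example (hI : Literature.Topology.FourManifolds.Iwase1988_gluckTwist_isTorusLinkSurgery.{0})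
    (hP : Summit.SmoothPoincare4.SmoothPoincare4.Theses.HyperbolicTorusFillings.LinkSurgeryPropertyP) :
    Literature.Topology.FourManifolds.GluckTwistConjecture.{0} :=
  Literature.Topology.FourManifolds.GluckTwistConjecture.of_iwase_of_torusSurgeryPropertyP hI
    (fun M _ _ _ _ _ n T A h e => hP M n T A h e)

end Summit.SmoothPoincare4.SmoothPoincare4.Cruxes.LinkSurgeryPropertyP.Birth

end
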